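import Summits.CriticalPhenomena.SAWScalingLimit.Theses.SAWResidueField

/-!
# Line `birth` — registered skeleton for the crux `HarmonicPartLimitR` (stmt-CriticalPhenomena-14055)

Crux (FIXED; rank 3 of `route-CriticalPhenomena-SAWResidueField`, sub-problem `SAWScalingLimit`): in the
setting of the repaired target `HexObservableLimitR` (flat horizontal boundary and exact row half-lattice
in a `ρ`-ball around BOTH marked points, `a_δ → a`, `b_δ → b` boundary mid-edges, `φ : Ω → ℍ`,
`L = log φ'` continuous with `L → L_b` at `b`) and for any residue potential `r_δ` (face relations of
`G*_δ := F_δ − P_δ`, `P_δ = Σ_x r_δ(x)·HexKernel.witness x`), there is ONE `c ≠ 0` with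

  `T_K(δ) := δ² Σ_{e ∈ K} ‖ G*_δ(e)/F_δ(b_δ) − c·e^{(5/8)(L(δe) − L_b)} ‖² → 0`   (`δ → 0⁺`, every compact `K ⊆ Ω`):

STRONG local `L²` convergence of the normalised discrete-holomorphic part `u_δ := G*_δ/F_δ(b_δ)` to the
DCS prediction `w := c·(φ'/φ'(b))^{5/8}`.

## The cut — polarisation (`weak + norm ⇒ strong`), the two named halves of "strongly, no staggered part, constant identified"

For every `δ` and every finite edge window the identity

  `‖u − w‖² = (‖u‖² − ‖w‖²) − 2·Re( conj(w)·(u − w) )`                                    (P)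

summed with the weight `δ²` over the mid-edges `e` with `δe ∈ K` gives, EXACTLY,

  `T_K(δ) = E_K(δ) − 2·Re C_K(δ)`,
  `E_K(δ) := δ² Σ_K ‖u_δ‖² − δ² Σ_K ‖w(δe)‖²`      (energy defect of `u_δ` against the prediction on `K`),
  `C_K(δ) := δ² Σ_K conj(w(δe))·(u_δ(e) − w(δe))`  (correlation defect: `⟨u_δ − w, w⟩_{ℓ²(K_δ), δ²}`).

So the crux is EQUIVALENT to the conjunction of two strictly weaker statements (each is implied by it —
Cauchy–Schwarz with `δ² Σ_K ‖w‖² = O(1)` for `C_K`, then (P) for `E_K` — and neither implies it alone: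
`u = w·(unimodular staggered phase)` has `E_K → 0`, `u = w + (orthogonal surplus)` has `C_K → 0`):

* S1 `stub_correlationIdentified` (HARDEST, open — "constant identified"): ONE universal `c ≠ 0` such that
  for every instance of the crux's hypothesis block and every compact `K ⊆ Ω`, `C_K(δ) → 0`: the
  normalised harmonic part is asymptotically fully correlated with the DCS prediction, with the right
  constant AND phase. This is the identification of the (weak) limit — the boundary conformal covariance
  of the crux's why-might-fail (argument = DCS Riemann BVP, modulus = Kennedy–Lawler boundary two-point
  function, `b`-normalisation on the flat good-zigzag piece) — tested against the one test-function family
  the synthesis needs, `1_K·conj(w)`.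
* S2 `stub_energyIdentity` (open — "no staggered `dz̄`-component"): for every `c ≠ 0` for which S1's
  matrix holds, `E_K(δ) → 0` for every instance and compact: the local `ℓ²` energy of `u_δ` is
  asymptotically EXACTLY the prediction's — no surplus carried by the vertex+face-holomorphic staggered
  mode `B·e^{−2iθ_e}` (which is invisible to every weak pairing: refuter note g48-1 on this item), no
  concentration, no loss. Interior regularity of fully discrete-holomorphic functions on the isoradial
  graph `ℍ` (Chelkak–Smirnov arXiv:0810.2188 §3) + the `b`-normalised a-priori bound.

`HarmonicPartLimitR_of` (kernel-checked, no `sorry` of its own) is the polarisation synthesis: finiteness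
of the edge windows (`hexDomainMidEdges_finite`), identity (P) summed (`finsum_norm_sub_sq`), and
`E_K − 2 Re C_K → 0 − 2·Re 0 = 0`; it concludes the route decl BY NAME through
`harmonicPartLimitR_iff : (∃ c ≠ 0, StrongAt c) ↔ HarmonicPartLimitR := Iff.rfl`.

Disproof / negatives used: no `Cruxes/HarmonicPartLimitR/Disproof.lean` exists (`ledger crux ls
stmt-CriticalPhenomena-14055`: no workfiles, 2026-08-17), so there is no `_false_without_` obstruction to
honour and no landed `Theorems/HarmonicPartLimitR/Negative/*`. `ledger negatives --problem
CriticalPhenomena` (11 entries): the only related one is the corridor refutation of the OLD target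
`HexObservableLimit` (stmt-5420, root pinned only Euclidean-ly); both stubs carry the crux's REPAIRED
hypothesis block verbatim (flat piece + exact row half-lattice at BOTH marked points, `m : Fin 2 → ℝ → ℤ`),
so neither is an instance of a refuted statement. Vacuity: if no instance satisfies the block the crux and
both stubs hold trivially alike; `K` with eventually empty edge window gives `T = E = C = 0`.
-/

noncomputable section

-- the route file's scopes, re-opened verbatim so that elaboration coincides with the crux's
open scoped BigOperators Topology Manifold Classical MeasureTheory ProbabilityTheory Matrix InnerProductSpace ComplexConjugate ContinuousMap
open Filter Set Function TopologicalSpace MeasureTheory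
open Literature.Probability.RandomPlanarGeometry Literature.Probability.RandomPlanarGeometry.SAW
open Literature.Probability.LatticeModels Literature.Barriers.CriticalPhenomena

namespace Summit.CriticalPhenomena.SAWScalingLimit.Cruxes.HarmonicPartLimitR.Birth

/-! ### 1. The three statements at a fixed constant `c` (the crux's hypothesis block VERBATIM) -/

/-- **Strong local `L²` convergence at constant `c`** — the crux's matrix: `HarmonicPartLimitR` is
literally `∃ c ≠ 0, StrongAt c` (`harmonicPartLimitR_iff`, `Iff.rfl`). -/
def StrongAt (c : ℂ) : Prop :=
  ∀ (D : DobrushinDomain) (ρ : ℝ) (Λ : ℝ → Finset HexVertex) (m : Fin 2 → ℝ → ℤ)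
    (a b : ℝ → Sym2 HexVertex) (Φ : ConformalEquiv D.carrier UpperHalfPlane.upperHalfPlaneSet)
    (L : ℂ → ℂ) (Lb : ℂ) (r : ℝ → Site 2 → ℂ),
  let F : ℝ → Sym2 HexVertex → ℂ := fun δ z =>
    hexParafermionicObservable (Λ δ) (a δ) hexCriticalFugacity (5 / 8) z
  let fullHex : ℝ → Set (Site 2) := fun δ => {x | HexKernel.hexagonFaces x ⊆ Λ δ}
  let pole : ℝ → Sym2 HexVertex → ℂ := fun δ e => ∑ᶠ x ∈ fullHex δ, r δ x * HexKernel.witness x e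
  let pair : (Sym2 HexVertex → ℂ) → Site 2 → ℂ := fun G x =>
    ∑ j : Fin 6, G (HexKernel.edge x j) * (starRingEnd ℂ) (HexKernel.val j)
  let region : ℝ → Set ℂ → Set (Sym2 HexVertex) := fun δ K =>
    {e | e ∈ hexDomainMidEdges (Λ δ) ∧ (δ : ℂ) * hexMidpoint e ∈ K}
  0 < ρ →
  (∀ i : Fin 2, D.carrier ∩ Metric.ball (D.pt i) ρ = {z : ℂ | (D.pt i).im < z.im} ∩ Metric.ball (D.pt i) ρ) →
  (∀ᶠ δ : ℝ in nhdsWithin 0 (Set.Ioi 0), hexDomainSimplyConnected (Λ δ) ∧ a δ ∈ hexDomainBoundary (Λ δ) ∧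
    b δ ∈ hexDomainBoundary (Λ δ) ∧ Nonempty (HexMidEdgeSAW (Λ δ) (a δ) (b δ)) ∧
    (hexGraph.induce ((Λ δ : Finset HexVertex) : Set HexVertex)).Preconnected ∧
    (∀ v ∈ Λ δ, (δ : ℂ) * hexCenter v ∈ D.carrier) ∧
    (∀ i : Fin 2, ∀ v : HexVertex, (δ : ℂ) * hexCenter v ∈ Metric.ball (D.pt i) ρ → (v ∈ Λ δ ↔ m i δ ≤ v.1 1))) →
  (∀ K : Set ℂ, IsCompact K → K ⊆ D.carrier → ∀ᶠ δ : ℝ in nhdsWithin 0 (Set.Ioi 0),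
    ∀ v : HexVertex, (δ : ℂ) * hexCenter v ∈ K → v ∈ Λ δ) →
  Filter.Tendsto (fun δ : ℝ => (δ : ℂ) * hexMidpoint (a δ)) (nhdsWithin 0 (Set.Ioi 0)) (nhds (D.pt 0)) →
  Filter.Tendsto (fun δ : ℝ => (δ : ℂ) * hexMidpoint (b δ)) (nhdsWithin 0 (Set.Ioi 0)) (nhds (D.pt 1)) →
  Filter.Tendsto (fun x => ‖Φ x‖) (nhdsWithin (D.pt 0) D.carrier) Filter.atTop →
  Φ.HasBoundaryValue (D.pt 1) 0 → ContinuousOn L D.carrier →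
  (∀ z ∈ D.carrier, Complex.exp (L z) = deriv Φ z) →
  Filter.Tendsto L (nhdsWithin (D.pt 1) D.carrier) (nhds Lb) →
  (∀ᶠ δ : ℝ in nhdsWithin 0 (Set.Ioi 0), ∀ x ∈ fullHex δ, pair (fun e => F δ e - pole δ e) x = 0) →
  ∀ K : Set ℂ, IsCompact K → K ⊆ D.carrier →
    Filter.Tendsto (fun δ : ℝ => δ ^ 2 * ∑ᶠ e ∈ region δ K,
      ‖(F δ e - pole δ e) / F δ (b δ) -
        c * Complex.exp ((5 / 8 : ℂ) * (L ((δ : ℂ) * hexMidpoint e) - Lb))‖ ^ 2)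
      (nhdsWithin 0 (Set.Ioi 0)) (nhds 0)

/-- **S1, named — correlation identified at constant `c`**: for every instance of the crux's hypothesis
block and every compact `K ⊆ Ω`, the correlation defect
`C_K(δ) = δ² Σ_{e ∈ K} conj(w(δe))·(u_δ(e) − w(δe))`, `u_δ = (F_δ − P_δ)/F_δ(b_δ)`,
`w = c·e^{(5/8)(L − L_b)}`, tends to `0` as `δ → 0⁺`. -/
def CorrelationAt (c : ℂ) : Prop :=
  ∀ (D : DobrushinDomain) (ρ : ℝ) (Λ : ℝ → Finset HexVertex) (m : Fin 2 → ℝ → ℤ)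
    (a b : ℝ → Sym2 HexVertex) (Φ : ConformalEquiv D.carrier UpperHalfPlane.upperHalfPlaneSet)
    (L : ℂ → ℂ) (Lb : ℂ) (r : ℝ → Site 2 → ℂ),
  let F : ℝ → Sym2 HexVertex → ℂ := fun δ z =>
    hexParafermionicObservable (Λ δ) (a δ) hexCriticalFugacity (5 / 8) z
  let fullHex : ℝ → Set (Site 2) := fun δ => {x | HexKernel.hexagonFaces x ⊆ Λ δ}
  let pole : ℝ → Sym2 HexVertex → ℂ := fun δ e => ∑ᶠ x ∈ fullHex δ, r δ x * HexKernel.witness x e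
  let pair : (Sym2 HexVertex → ℂ) → Site 2 → ℂ := fun G x =>
    ∑ j : Fin 6, G (HexKernel.edge x j) * (starRingEnd ℂ) (HexKernel.val j)
  let region : ℝ → Set ℂ → Set (Sym2 HexVertex) := fun δ K =>
    {e | e ∈ hexDomainMidEdges (Λ δ) ∧ (δ : ℂ) * hexMidpoint e ∈ K}
  0 < ρ →
  (∀ i : Fin 2, D.carrier ∩ Metric.ball (D.pt i) ρ = {z : ℂ | (D.pt i).im < z.im} ∩ Metric.ball (D.pt i) ρ) →
  (∀ᶠ δ : ℝ in nhdsWithin 0 (Set.Ioi 0), hexDomainSimplyConnected (Λ δ) ∧ a δ ∈ hexDomainBoundary (Λ δ) ∧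
    b δ ∈ hexDomainBoundary (Λ δ) ∧ Nonempty (HexMidEdgeSAW (Λ δ) (a δ) (b δ)) ∧
    (hexGraph.induce ((Λ δ : Finset HexVertex) : Set HexVertex)).Preconnected ∧
    (∀ v ∈ Λ δ, (δ : ℂ) * hexCenter v ∈ D.carrier) ∧
    (∀ i : Fin 2, ∀ v : HexVertex, (δ : ℂ) * hexCenter v ∈ Metric.ball (D.pt i) ρ → (v ∈ Λ δ ↔ m i δ ≤ v.1 1))) →
  (∀ K : Set ℂ, IsCompact K → K ⊆ D.carrier → ∀ᶠ δ : ℝ in nhdsWithin 0 (Set.Ioi 0),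
    ∀ v : HexVertex, (δ : ℂ) * hexCenter v ∈ K → v ∈ Λ δ) →
  Filter.Tendsto (fun δ : ℝ => (δ : ℂ) * hexMidpoint (a δ)) (nhdsWithin 0 (Set.Ioi 0)) (nhds (D.pt 0)) →
  Filter.Tendsto (fun δ : ℝ => (δ : ℂ) * hexMidpoint (b δ)) (nhdsWithin 0 (Set.Ioi 0)) (nhds (D.pt 1)) →
  Filter.Tendsto (fun x => ‖Φ x‖) (nhdsWithin (D.pt 0) D.carrier) Filter.atTop →
  Φ.HasBoundaryValue (D.pt 1) 0 → ContinuousOn L D.carrier →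
  (∀ z ∈ D.carrier, Complex.exp (L z) = deriv Φ z) →
  Filter.Tendsto L (nhdsWithin (D.pt 1) D.carrier) (nhds Lb) →
  (∀ᶠ δ : ℝ in nhdsWithin 0 (Set.Ioi 0), ∀ x ∈ fullHex δ, pair (fun e => F δ e - pole δ e) x = 0) →
  ∀ K : Set ℂ, IsCompact K → K ⊆ D.carrier →
    Filter.Tendsto (fun δ : ℝ => (δ : ℂ) ^ 2 * ∑ᶠ e ∈ region δ K,
      (starRingEnd ℂ) (c * Complex.exp ((5 / 8 : ℂ) * (L ((δ : ℂ) * hexMidpoint e) - Lb))) *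
        ((F δ e - pole δ e) / F δ (b δ) -
          c * Complex.exp ((5 / 8 : ℂ) * (L ((δ : ℂ) * hexMidpoint e) - Lb))))
      (nhdsWithin 0 (Set.Ioi 0)) (nhds 0)

/-- **S2, named — energy identity at constant `c`**: for every instance of the crux's hypothesis block
and every compact `K ⊆ Ω`, the energy defect
`E_K(δ) = δ² Σ_{e ∈ K} ‖u_δ(e)‖² − δ² Σ_{e ∈ K} ‖w(δe)‖²` tends to `0` as `δ → 0⁺`. -/
def EnergyAt (c : ℂ) : Prop :=
  ∀ (D : DobrushinDomain) (ρ : ℝ) (Λ : ℝ → Finset HexVertex) (m : Fin 2 → ℝ → ℤ)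
    (a b : ℝ → Sym2 HexVertex) (Φ : ConformalEquiv D.carrier UpperHalfPlane.upperHalfPlaneSet)
    (L : ℂ → ℂ) (Lb : ℂ) (r : ℝ → Site 2 → ℂ),
  let F : ℝ → Sym2 HexVertex → ℂ := fun δ z =>
    hexParafermionicObservable (Λ δ) (a δ) hexCriticalFugacity (5 / 8) z
  let fullHex : ℝ → Set (Site 2) := fun δ => {x | HexKernel.hexagonFaces x ⊆ Λ δ}
  let pole : ℝ → Sym2 HexVertex → ℂ := fun δ e => ∑ᶠ x ∈ fullHex δ, r δ x * HexKernel.witness x e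
  let pair : (Sym2 HexVertex → ℂ) → Site 2 → ℂ := fun G x =>
    ∑ j : Fin 6, G (HexKernel.edge x j) * (starRingEnd ℂ) (HexKernel.val j)
  let region : ℝ → Set ℂ → Set (Sym2 HexVertex) := fun δ K =>
    {e | e ∈ hexDomainMidEdges (Λ δ) ∧ (δ : ℂ) * hexMidpoint e ∈ K}
  0 < ρ →
  (∀ i : Fin 2, D.carrier ∩ Metric.ball (D.pt i) ρ = {z : ℂ | (D.pt i).im < z.im} ∩ Metric.ball (D.pt i) ρ) →
  (∀ᶠ δ : ℝ in nhdsWithin 0 (Set.Ioi 0), hexDomainSimplyConnected (Λ δ) ∧ a δ ∈ hexDomainBoundary (Λ δ) ∧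
    b δ ∈ hexDomainBoundary (Λ δ) ∧ Nonempty (HexMidEdgeSAW (Λ δ) (a δ) (b δ)) ∧
    (hexGraph.induce ((Λ δ : Finset HexVertex) : Set HexVertex)).Preconnected ∧
    (∀ v ∈ Λ δ, (δ : ℂ) * hexCenter v ∈ D.carrier) ∧
    (∀ i : Fin 2, ∀ v : HexVertex, (δ : ℂ) * hexCenter v ∈ Metric.ball (D.pt i) ρ → (v ∈ Λ δ ↔ m i δ ≤ v.1 1))) →
  (∀ K : Set ℂ, IsCompact K → K ⊆ D.carrier → ∀ᶠ δ : ℝ in nhdsWithin 0 (Set.Ioi 0),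
    ∀ v : HexVertex, (δ : ℂ) * hexCenter v ∈ K → v ∈ Λ δ) →
  Filter.Tendsto (fun δ : ℝ => (δ : ℂ) * hexMidpoint (a δ)) (nhdsWithin 0 (Set.Ioi 0)) (nhds (D.pt 0)) →
  Filter.Tendsto (fun δ : ℝ => (δ : ℂ) * hexMidpoint (b δ)) (nhdsWithin 0 (Set.Ioi 0)) (nhds (D.pt 1)) →
  Filter.Tendsto (fun x => ‖Φ x‖) (nhdsWithin (D.pt 0) D.carrier) Filter.atTop →
  Φ.HasBoundaryValue (D.pt 1) 0 → ContinuousOn L D.carrier →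
  (∀ z ∈ D.carrier, Complex.exp (L z) = deriv Φ z) →
  Filter.Tendsto L (nhdsWithin (D.pt 1) D.carrier) (nhds Lb) →
  (∀ᶠ δ : ℝ in nhdsWithin 0 (Set.Ioi 0), ∀ x ∈ fullHex δ, pair (fun e => F δ e - pole δ e) x = 0) →
  ∀ K : Set ℂ, IsCompact K → K ⊆ D.carrier →
    Filter.Tendsto (fun δ : ℝ => δ ^ 2 *
      ((∑ᶠ e ∈ region δ K, ‖(F δ e - pole δ e) / F δ (b δ)‖ ^ 2) -
        ∑ᶠ e ∈ region δ K, ‖c * Complex.exp ((5 / 8 : ℂ) * (L ((δ : ℂ) * hexMidpoint e) - Lb))‖ ^ 2))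
      (nhdsWithin 0 (Set.Ioi 0)) (nhds 0)

/-! ### 2. The two statements of the line, named -/

/-- **S1 — correlation identified (HARDEST).** ONE universal constant `c ≠ 0` such that `CorrelationAt c`:
the `F_δ(b_δ)`-normalised discrete-holomorphic part of the SAW parafermion is asymptotically fully
correlated, on every compact, with the DCS prediction `c·e^{(5/8)(L − L_b)} = c·(φ'/φ'(b))^{5/8}`
(identification of the limit, constant and phase: boundary conformal covariance). -/
def CorrelationIdentified : Prop := ∃ c : ℂ, c ≠ 0 ∧ CorrelationAt c

/-- **S2 — energy identity (no `L²` defect).** For every `c ≠ 0` whose correlation statement holds, the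
local energies match: `CorrelationAt c → EnergyAt c` — no energy is carried by modes invisible to the
pairing (the staggered `B·e^{−2iθ}` mode, concentration, escape). -/
def EnergyIdentity : Prop := ∀ c : ℂ, c ≠ 0 → CorrelationAt c → EnergyAt c

/-- The crux IS `∃ c ≠ 0, StrongAt c` (delta on the route decl, then syntactic identity of the matrix). -/
theorem harmonicPartLimitR_iff :
    (∃ c : ℂ, c ≠ 0 ∧ StrongAt c) ↔
      Summit.CriticalPhenomena.SAWScalingLimit.Theses.SAWResidueField.HarmonicPartLimitR :=
  Iff.rfl

/-! ### 3. The registered stubs (the ONLY `sorry`s of this file) -/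

/-- **S1 (HARDEST, open) — correlation identified**: `∃ c ≠ 0, CorrelationAt c`. The conformal content
of the crux: the limit of `u_δ = G*_δ/F_δ(b_δ)` is identified, with its constant, by the boundary data of
the determined function `G*_δ` (argument: DCS Riemann BVP `Im(F·τ^{5/8}) = 0`; modulus: boundary SAW
two-point function, Kennedy–Lawler lattice factors neutralised by the flat good-zigzag piece at `b`),
tested against `1_K·conj(c e^{(5/8)(L − L_b)})`. Why it might fail: exactly the crux's recorded risk
(boundary conformal covariance open; CS theory gives precompactness only; free collar off `a`, `b`). -/
theorem stub_correlationIdentified : CorrelationIdentified := by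
  sorry

/-- **S2 (open) — energy identity / no staggered component**: `∀ c ≠ 0, CorrelationAt c → EnergyAt c`.
Given the identification in correlation, the `δ²`-weighted `ℓ²` energy of `u_δ` on every compact is
asymptotically the prediction's: the vertex+face-holomorphic staggered mode and any concentration carry
no energy in the limit (interior regularity of discrete-holomorphic functions on `ℍ`, Chelkak–Smirnov
§3, plus the normalised a-priori bound). Why it might fail: the staggered `dz̄`-mode of `G*_δ` is exactly
discrete-holomorphic on `ℍ`, so nothing at the lattice level damps it — its absence is an asymptotic
statement about the SAW, unproved. -/
theorem stub_energyIdentity : EnergyIdentity := by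
  sorry

/-! ### Consistency: each named statement IS its registered stub -/

theorem correlationIdentified_holds : CorrelationIdentified := stub_correlationIdentified
theorem energyIdentity_holds : EnergyIdentity := stub_energyIdentity

/-! ### Name-keyed aliases of the two statements — the hypotheses of `HarmonicPartLimitR_of`

The skeleton audit (`#h21_check_skeleton`) admits a hypothesis of the skeleton theorem only if its head
constant is a registered obligation or is NAMED like a declared stub; `__Registered.stub_X` is the statement
of `stub_X` under that name (device of `Cruxes/AxiomsOfLimit/Lines/birth.lean` and
`Cruxes/AsymptoticMorera/Lines/birth.lean`). Each alias is `rfl`-equal to its statement. -/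
namespace __Registered

/-- Alias of `CorrelationIdentified` keyed by the registered stub name. -/
abbrev stub_correlationIdentified : Prop := CorrelationIdentified
/-- Alias of `EnergyIdentity` keyed by the registered stub name. -/
abbrev stub_energyIdentity : Prop := EnergyIdentity

end __Registered

/-! ### 4. The sorry-free part: finiteness of edge windows, polarisation, the limit algebra -/

/-- The mid-edges of a finite hexagonal domain form a finite set (each lies at a vertex of `Λ`, towards
one of its three neighbours `HexGreen.nbrs`), so every `finsum` below is a genuine finite sum. [folklore] -/
theorem hexDomainMidEdges_finite (Λ : Finset HexVertex) : (hexDomainMidEdges Λ).Finite := by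
  classical
  refine (Finset.finite_toSet (Λ.biUnion fun v => (HexGreen.nbrs v).image fun w => s(v, w))).subset ?_
  intro e
  induction e using Sym2.ind with
  | h x y =>
    rintro ⟨he, v, hv, hvΛ⟩
    rw [SimpleGraph.mem_edgeSet] at he
    simp only [Finset.mem_coe, Finset.coe_biUnion, Finset.coe_image, Set.mem_iUnion, Set.mem_image,
      exists_prop]
    rcases Sym2.mem_iff.1 hv with hvx | hvy
    · rw [hvx] at hvΛ
      exact ⟨x, hvΛ, y, (HexGreen.mem_nbrs_iff x y).2 he, rfl⟩
    · rw [hvy] at hvΛ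
      exact ⟨y, hvΛ, x, (HexGreen.mem_nbrs_iff y x).2 he.symm, Sym2.eq_swap⟩

/-- The edge window of a compact (indeed of any set) `K` at mesh `δ` is finite. [folklore] -/
theorem region_finite (Λ : Finset HexVertex) (δ : ℝ) (K : Set ℂ) :
    {e : Sym2 HexVertex | e ∈ hexDomainMidEdges Λ ∧ (δ : ℂ) * hexMidpoint e ∈ K}.Finite :=
  (hexDomainMidEdges_finite Λ).subset fun _ he => he.1

/-- **Polarisation (P)**: `‖u − w‖² = (‖u‖² − ‖w‖²) − 2 Re(conj(w)(u − w))` in `ℂ`. [folklore] -/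
theorem norm_sub_sq_polar (u w : ℂ) :
    ‖u - w‖ ^ 2 = (‖u‖ ^ 2 - ‖w‖ ^ 2) - 2 * ((starRingEnd ℂ) w * (u - w)).re := by
  simp only [Complex.sq_norm, Complex.normSq_apply, Complex.mul_re, Complex.sub_re, Complex.sub_im,
    Complex.conj_re, Complex.conj_im]
  ring

/-- (P) summed over a finite window. [folklore] -/
theorem finsum_norm_sub_sq {ι : Type*} {s : Set ι} (hs : s.Finite) (u w : ι → ℂ) :
    ∑ᶠ i ∈ s, ‖u i - w i‖ ^ 2 =
      ((∑ᶠ i ∈ s, ‖u i‖ ^ 2) - ∑ᶠ i ∈ s, ‖w i‖ ^ 2) -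
        2 * (∑ᶠ i ∈ s, (starRingEnd ℂ) (w i) * (u i - w i)).re := by
  simp only [finsum_mem_eq_finite_toFinset_sum _ hs]
  rw [Complex.re_sum, Finset.mul_sum, ← Finset.sum_sub_distrib, ← Finset.sum_sub_distrib]
  exact Finset.sum_congr rfl fun i _ => norm_sub_sq_polar (u i) (w i)

/-- (P) with the `δ²` weights: `T = E − 2 Re C` window by window. [folklore] -/
theorem weighted_polar {ι : Type*} (s : ℝ → Set ι) (hs : ∀ δ, (s δ).Finite) (u w : ℝ → ι → ℂ)
    (δ : ℝ) :
    δ ^ 2 * ∑ᶠ i ∈ s δ, ‖u δ i - w δ i‖ ^ 2 =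
      δ ^ 2 * ((∑ᶠ i ∈ s δ, ‖u δ i‖ ^ 2) - ∑ᶠ i ∈ s δ, ‖w δ i‖ ^ 2) -
        2 * ((δ : ℂ) ^ 2 * ∑ᶠ i ∈ s δ, (starRingEnd ℂ) (w δ i) * (u δ i - w δ i)).re := by
  rw [finsum_norm_sub_sq (hs δ), ← Complex.ofReal_pow, Complex.re_ofReal_mul]
  ring

/-- **`weak + norm ⇒ strong`, quantitatively**: if the energy defect `E(δ)` and the correlation defect
`C(δ)` of `u_δ` against `w_δ` on the windows `s δ` tend to `0` along a filter, so does
`T(δ) = δ² Σ ‖u_δ − w_δ‖²`. [folklore] -/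
theorem tendsto_sq_norm_sub_of_energy_of_correlation {ι : Type*} {l : Filter ℝ} (s : ℝ → Set ι)
    (hs : ∀ δ, (s δ).Finite) (u w : ℝ → ι → ℂ)
    (hE : Tendsto (fun δ : ℝ => δ ^ 2 * ((∑ᶠ i ∈ s δ, ‖u δ i‖ ^ 2) - ∑ᶠ i ∈ s δ, ‖w δ i‖ ^ 2))
      l (nhds 0))
    (hC : Tendsto (fun δ : ℝ => (δ : ℂ) ^ 2 * ∑ᶠ i ∈ s δ, (starRingEnd ℂ) (w δ i) * (u δ i - w δ i))
      l (nhds 0)) :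
    Tendsto (fun δ : ℝ => δ ^ 2 * ∑ᶠ i ∈ s δ, ‖u δ i - w δ i‖ ^ 2) l (nhds 0) := by
  have hre : Tendsto (fun δ : ℝ =>
      2 * ((δ : ℂ) ^ 2 * ∑ᶠ i ∈ s δ, (starRingEnd ℂ) (w δ i) * (u δ i - w δ i)).re) l (nhds 0) := by
    have h := ((Complex.continuous_re.tendsto 0).comp hC).const_mul 2
    simpa using h
  have h := hE.sub hre
  rw [sub_zero] at h
  refine h.congr' (Filter.Eventually.of_forall fun δ => ?_)
  exact (weighted_polar s hs u w δ).symm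

/-- **The composition at a fixed constant** (no `sorry`): `CorrelationAt c → EnergyAt c → StrongAt c`. -/
theorem strongAt_of {c : ℂ} (hC : CorrelationAt c) (hE : EnergyAt c) : StrongAt c := by
  intro D ρ Λ m a b Φ L Lb r
  have hC1 := hC D ρ Λ m a b Φ L Lb r
  have hE1 := hE D ρ Λ m a b Φ L Lb r
  dsimp only at hC1 hE1 ⊢
  intro hρ hflat hadm hexh ha hb hΦa hΦb hLc hLexp hLb hres K hK hKD
  have hC2 := hC1 hρ hflat hadm hexh ha hb hΦa hΦb hLc hLexp hLb hres K hK hKD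
  have hE2 := hE1 hρ hflat hadm hexh ha hb hΦa hΦb hLc hLexp hLb hres K hK hKD
  exact tendsto_sq_norm_sub_of_energy_of_correlation _ (fun δ => region_finite (Λ δ) δ K) _ _ hE2 hC2

/-! ### 5. The skeleton theorem: the two stubs imply the crux, BY NAME -/

/-- **`HarmonicPartLimitR` from the line `birth`** (kernel-checked, no `sorry` of its own): hypotheses =
the two stubs under their registered names; conclusion = the route decl, by name. The constant of the
crux is S1's constant; S2 supplies the energy identity at that constant; polarisation concludes. -/
theorem HarmonicPartLimitR_of (h1 : __Registered.stub_correlationIdentified)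
    (h2 : __Registered.stub_energyIdentity) :
    Summit.CriticalPhenomena.SAWScalingLimit.Theses.SAWResidueField.HarmonicPartLimitR := by
  obtain ⟨c, hc, hC⟩ := h1
  exact harmonicPartLimitR_iff.mp ⟨c, hc, strongAt_of hC (h2 c hc hC)⟩

-- wiring check: the stubs themselves feed the skeleton theorem
example : Summit.CriticalPhenomena.SAWScalingLimit.Theses.SAWResidueField.HarmonicPartLimitR :=
  HarmonicPartLimitR_of stub_correlationIdentified stub_energyIdentity

end Summit.CriticalPhenomena.SAWScalingLimit.Cruxes.HarmonicPartLimitR.Birth
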